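import Mathlib
import Summits.Ventures.PercRepro2.HCovCubic
import Summits.Ventures.PercRepro2.HalfL

/-!
# The `L`-half as a three-copy cubic form: the bridge to the typed bases (blind cell PercRepro2, night-1 g35)

`ΓLc = D · P(Q) · Γ_L` (`SharpHalves.GammaLc`) is a sum of nineteen products of three masses, hence
(`CovForm.triSum_empty_sepKernel`, HCovCubic.lean) the cubic form `Σ_{x,y,z} P(x) P(y) P(z) K_L(x,y,z)` of
the separable kernel

  `K_L = 1_Q(x) 1_PD(y) [1_{Q,oL,bL} − 1_{Q,oH,bL} − 1_{T′,oL,bL} − 1_{T′,oH,bL} + 1_{T,oL,bL} + 1_{T,oH,bL} − 1_{PD,oL,bL} − 1_{PD,oH,bL}](z)`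
  `  + 1_Q(x) f₃(y) [1_{T′,bL} − 1_{T,bL}](z) + 1_Q(x) 1_{PD,bL}(y) f₃(z)`
  `  − 1_{Q,bL}(x) 1_PD(y) [1_{Q,oL} − 1_{Q,oH} − 1_{T′,oL} − 1_{T′,oH} + 1_{T,oL} + 1_{T,oH}](z) − 1_{Q,bL}(x) f₃(y) [1_{T′} − 1_{T}](z)`

(`f₃ = 1_PD 1_{o∈U}`, `E[f₃] = D_o`; `T = Q ∩ {a₃ ∈ H}`, `T′ = Q ∩ {a₃ ∈ L}`):

* **`halfL_cubic`**: `ΓLc = triSum p ∅ τ K_L`;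
* **`HalfL_of_pinned`**: if every typed three-copy sum of `K_L` with the free edges pinned is
  nonnegative (p1's `triSum_nonneg_of_pinned`), then HALF-L holds for every admissible weight vector —
  the weight-free typed-base form of the hypothesis is p1's `typedCount` (`TriDisagreementPinned.lean`).

Census (night-1 g35, own C enumerator, kit j335788/9): 54,383,616 typed bases of `K_L` on 4,800 random
instances `n = 5–7`, `m ≤ 9` — 0 negative, every base an even integer (the control: the refuted sharp
centring has 21 negative bases on its 5-vertex witness).  So the cell's 2′TRI road applies to the
halves, and (HCOV) ⟸ HALF-L ∧ HALF-H (`HalfL.lean`) ⟸ the typed bases of `K_L` (and of its root mirror).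
-/

namespace Summit.Ventures.PercRepro2

namespace SharpHalves

open CovForm

section Kernel

variable {V : Type*} {E : Type*} [Fintype E] [DecidableEq E] [DecidableEq V] {R : Type*}
  [Field R] [LinearOrder R] [IsStrictOrderedRing R]

/-- The indicator of an event as a function. -/
noncomputable def ind (S : Set (Config E)) : Config E → R := fun ω => S.indicator 1 ω

omit [DecidableEq V] [LinearOrder R] [IsStrictOrderedRing R] in
/-- `E[1_S] = P(S)`. -/
lemma expect_ind (p : E → R) (S : Set (Config E)) : expect p (ind S) = prob p S :=
  expect_ind1 p S

/-- **The nineteen-term kernel `K_L` of the `L`-half** (copies `x, y, z` in this order). -/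
noncomputable def KL (ends : E → Sym2 V) (o a₁ a₂ a₃ b : V) :
    Config E → Config E → Config E → R :=
  sepKernel ![1, -1, 1, -1, -1, -1, 1, 1, -1, 1, -1, 1, 1, 1, -1, -1, -1, -1, 1]
    ![iQ ends a₁ a₂, iQ ends a₁ a₂, iQ ends a₁ a₂, iQ ends a₁ a₂, iQ ends a₁ a₂, iQ ends a₁ a₂,
      iQ ends a₁ a₂, iQ ends a₁ a₂,
      ind (avoidAll ends a₂ {a₁} ∩ connEvent ends a₁ b), ind (avoidAll ends a₂ {a₁} ∩ connEvent ends a₁ b),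
      ind (avoidAll ends a₂ {a₁} ∩ connEvent ends a₁ b), ind (avoidAll ends a₂ {a₁} ∩ connEvent ends a₁ b),
      ind (avoidAll ends a₂ {a₁} ∩ connEvent ends a₁ b), ind (avoidAll ends a₂ {a₁} ∩ connEvent ends a₁ b),
      ind (avoidAll ends a₂ {a₁} ∩ connEvent ends a₁ b), ind (avoidAll ends a₂ {a₁} ∩ connEvent ends a₁ b),
      iQ ends a₁ a₂, iQ ends a₁ a₂, iQ ends a₁ a₂]
    ![iPD ends a₁ a₂ a₃, iPD ends a₁ a₂ a₃, f3 ends o a₁ a₂ a₃, f3 ends o a₁ a₂ a₃,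
      iPD ends a₁ a₂ a₃, iPD ends a₁ a₂ a₃, iPD ends a₁ a₂ a₃, iPD ends a₁ a₂ a₃,
      iPD ends a₁ a₂ a₃, iPD ends a₁ a₂ a₃, f3 ends o a₁ a₂ a₃, f3 ends o a₁ a₂ a₃,
      iPD ends a₁ a₂ a₃, iPD ends a₁ a₂ a₃, iPD ends a₁ a₂ a₃, iPD ends a₁ a₂ a₃,
      iPD ends a₁ a₂ a₃, iPD ends a₁ a₂ a₃, ind (PDEvent ends a₁ a₂ a₃ ∩ connEvent ends a₁ b)]
    ![ind (avoidAll ends a₂ {a₁} ∩ (connEvent ends a₁ o ∩ connEvent ends a₁ b)),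
      ind (avoidAll ends a₂ {a₁} ∩ (connEvent ends a₂ o ∩ connEvent ends a₁ b)),
      ind (TEvent ends a₂ a₁ a₃ ∩ connEvent ends a₁ b),
      ind (TEvent ends a₁ a₂ a₃ ∩ connEvent ends a₁ b),
      ind (TEvent ends a₂ a₁ a₃ ∩ (connEvent ends a₁ o ∩ connEvent ends a₁ b)),
      ind (TEvent ends a₂ a₁ a₃ ∩ (connEvent ends a₂ o ∩ connEvent ends a₁ b)),
      ind (TEvent ends a₁ a₂ a₃ ∩ (connEvent ends a₁ o ∩ connEvent ends a₁ b)),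
      ind (TEvent ends a₁ a₂ a₃ ∩ (connEvent ends a₂ o ∩ connEvent ends a₁ b)),
      ind (avoidAll ends a₂ {a₁} ∩ connEvent ends a₁ o),
      ind (avoidAll ends a₂ {a₁} ∩ connEvent ends a₂ o),
      ind (TEvent ends a₂ a₁ a₃), ind (TEvent ends a₁ a₂ a₃),
      ind (TEvent ends a₂ a₁ a₃ ∩ connEvent ends a₁ o), ind (TEvent ends a₂ a₁ a₃ ∩ connEvent ends a₂ o),
      ind (TEvent ends a₁ a₂ a₃ ∩ connEvent ends a₁ o), ind (TEvent ends a₁ a₂ a₃ ∩ connEvent ends a₂ o),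
      ind (PDEvent ends a₁ a₂ a₃ ∩ (connEvent ends a₁ o ∩ connEvent ends a₁ b)),
      ind (PDEvent ends a₁ a₂ a₃ ∩ (connEvent ends a₂ o ∩ connEvent ends a₁ b)),
      f3 ends o a₁ a₂ a₃]

omit [DecidableEq V] [LinearOrder R] [IsStrictOrderedRing R] in
/-- **`halfL_cubic`**: `ΓLc` is the cubic form `Σ_{x,y,z} P(x) P(y) P(z) K_L(x,y,z)`. -/
theorem halfL_cubic (p : E → R) (ends : E → Sym2 V) (o a₁ a₂ a₃ b : V) (τ : E → ℕ) :
    GammaLc p ends o a₁ a₂ a₃ b = triSum p ∅ τ (KL ends o a₁ a₂ a₃ b) := by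
  unfold KL
  rw [triSum_empty_sepKernel]
  simp only [Fin.sum_univ_succ, Fin.sum_univ_zero, Matrix.cons_val_zero, Matrix.cons_val_succ,
    add_zero]
  simp only [expect_ind, expect_f1, expect_f2, expect_f3]
  unfold GammaLc DEF EQo EQ3 EQ3o
  ring

omit [DecidableEq V] in
/-- **HALF-L from the typed three-copy bases of `K_L`** (p1's `triSum_nonneg_of_pinned`). -/
theorem HalfL_of_pinned (ends : E → Sym2 V) (o a₁ a₂ a₃ b : V)
    (hbase : ∀ (q : E → R) (G : Finset E) (σ : E → ℕ), (∀ e, 0 ≤ q e ∧ q e ≤ 1) →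
      (∀ e, e ∉ G → q e = 0 ∨ q e = 1) → (∀ e ∈ G, σ e = 1 ∨ σ e = 2) →
      0 ≤ triSum q G σ (KL ends o a₁ a₂ a₃ b))
    (p : E → R) (hp : IsProbVec p) : HalfL p ends o a₁ a₂ a₃ b := by
  unfold HalfL
  rw [halfL_cubic p ends o a₁ a₂ a₃ b (fun _ => 0)]
  exact triSum_nonneg_of_pinned (KL ends o a₁ a₂ a₃ b) hbase p
    (fun e => ⟨hp.nonneg e, hp.le_one e⟩) ∅ (fun _ => 0)
    (fun e he => absurd he (Finset.notMem_empty e))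

end Kernel

section Closure

variable (R : Type*) [Field R] [LinearOrder R] [IsStrictOrderedRing R]

/-- **The typed-base statement of the `L`-half for every finite graph and every labelling**: every
typed three-copy sum of `K_L` with the free edges pinned is nonnegative. -/
def HalfLBases_all : Prop :=
  ∀ (V E : Type) [Fintype V] [DecidableEq V] [Fintype E] [DecidableEq E]
    (ends : E → Sym2 V) (o a₁ a₂ a₃ b : V), a₁ ≠ a₂ → a₁ ≠ a₃ → a₂ ≠ a₃ → o ≠ a₁ → o ≠ a₂ →
      o ≠ a₃ → o ≠ b → b ≠ a₁ → b ≠ a₂ → b ≠ a₃ →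
      ∀ (q : E → R) (G : Finset E) (σ : E → ℕ), (∀ e, 0 ≤ q e ∧ q e ≤ 1) →
        (∀ e, e ∉ G → q e = 0 ∨ q e = 1) → (∀ e ∈ G, σ e = 1 ∨ σ e = 2) →
        0 ≤ triSum q G σ (KL ends o a₁ a₂ a₃ b)

/-- **`HalfL_all ⟸ HalfLBases_all`.** -/
theorem HalfL_all_of_bases (h : HalfLBases_all R) : HalfL_all R := by
  intro V E _ _ _ _ ends p hp o a₁ a₂ a₃ b h12 h13 h23 ho1 ho2 ho3 hob hb1 hb2 hb3
  exact HalfL_of_pinned ends o a₁ a₂ a₃ b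
    (h V E ends o a₁ a₂ a₃ b h12 h13 h23 ho1 ho2 ho3 hob hb1 hb2 hb3) p hp

/-- **The chain in the kernel: `HCov_all ⟸ HalfLBases_all`** — (HCOV) for every finite graph from the
typed bases of the `L`-half (the root mirror is covered by the labelling-free quantification). -/
theorem HCov_all_of_bases (h : HalfLBases_all R) : HCov_all R :=
  HCov_all_of_HalfL_all R (HalfL_all_of_bases R h)

end Closure

end SharpHalves

end Summit.Ventures.PercRepro2
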